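import Summits.CriticalPhenomena.PercolationContinuityZ3.Theses.PercNonProliferation
import Summits.CriticalPhenomena.PercolationContinuityZ3.Theorems.FreeBoxPowerSaving.Negative.FreeBoxPowerSavingBounds
import HarnessLib.Audit

/-!
# Line `boundary-interior-split-fat-finite-clusters` — skeleton for crux `FreeBoxPowerSaving`
# (stmt-CriticalPhenomena-4447, route `PercNonProliferation`, r5)

Crux (by name, `Summit.CriticalPhenomena.PercolationContinuityZ3.Theses.PercNonProliferation.FreeBoxPowerSaving`):
`∃ a C, 0 < a ∧ ∀ n ≥ 1, FA₂(p_c, n) ≤ C n^{-a}`, where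
`FA₂(p, n) = |Λ_n|⁻² Σ_{x,y ∈ Λ_n} P_p(x ↔ y inside Λ_n)`, `Λ_n = box 3 n = [-n,n]³`, bond percolation
on `ℤ³`, `p_c = criticalProbI 3`.

THE LINE (idea card `Ideas/boundary-interior-split-fat-finite-clusters.md`, sharpened by the r1
triage panel `TRIAGE-r1-{1,2,3}.md`).  Write `N_n(u, ω) = #{v ∈ Λ_n : u ↔ v inside Λ_n}` for the
size of the in-box piece of `u`, `QG_n(s) = {∃ u ∈ Λ_n, N_n(u) ≥ s}` ("some in-box piece has `≥ s`
vertices", i.e. `|K_max^free(Λ_n)| ≥ s`) and `BQG_n(s) = {∃ u ∈ ∂ⁱⁿΛ_n, N_n(u) ≥ s}` ("some piece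
TOUCHING THE INNER VERTEX BOUNDARY has `≥ s` vertices").  The free boundary splits the in-box
pieces EXACTLY into boundary-touching pieces and interior pieces, and on the full-measure event
`ω ⊆ E(ℤ³)` an interior piece IS a full (finite) `ℤ³`-cluster confined to `Λ_n ⊆ v + Λ_{2n}`.
Hence (one-bit currency of the sibling card `tightness-collapse-typical-kmax`, as all three triagers
asked):

* `stub_boundaryInteriorSplit` (the split + two Markov inequalities + translation invariance;
  every `p`; provable now, size M):
  `P_p(QG_n(s)) ≤ P_p(BQG_n(s)) + |Λ_n| · E_p[|C(0)| ; C(0) ⊆ Λ_{2n}] / s²`  (`s > 0`).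
* `stub_fatFiniteClusters` = the card's (I) `FatFiniteClusterBound`, verbatim (triage r1-2
  sharpening): `E_{p_c}[|C(0)| ; C(0) ⊆ Λ_{2n}] ≤ C n^{3-a}` for some `a > 0` — a JUMP-FREE statement
  about FINITE critical clusters ("confined clusters are not fat"), strictly weaker than bulk ball
  decay (PercTwoPointDecay's `X_A`), implied by the crux (Disproof §6), located nowhere in print for
  `d = 3`.  The line's distinctive bet; open, size L–XL.
* `stub_boundaryQuasiGiantsNotAS` = the card's (B) in constant-probability form
  `BoundaryQuasiGiantNotAS(a, ε)` (triage r1-1/2/3: drop the depth-profile RATE sub-route, which is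
  summit-strength): eventually `P_{p_c}(BQG_n(n^{3-a})) ≤ 1 - ε`.  ALL jump-world (monolithic-branch)
  content of the crux sits here; the criticality of the parameter is used here (false at `p = 1`).
  HARDEST stub (crux-hard; no mechanism beyond BGN-type half-space/orthant arguments yet).
* `stub_sizeSplitting` (the square-root trick = `k = 1` of Hutchcroft's BK size-multiplicativity,
  arXiv:2008.11197 Thm 2.3, re-derived elementarily by triage r1-2 App. A: spanning-tree peeling into
  two edge-disjoint open subtrees + `bk_finitary_list`; every `p`; provable now, size M):
  `P_p(QG_n(3s)) ≤ P_p(QG_n(s))²` for real `s ≥ 1`.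
* `stub_logBoost` (the tightness collapse, card 1's `FirstLemma1` with the square-root trick as its
  hypothesis; real analysis, provable now, size M): size-splitting + "`QG_n(n^{3-a})` has probability
  `≤ 1 - ε` eventually" ⟹ an eventual power saving `FA₂(p, n) ≤ C n^{-a'}` (iterate to
  `P(QG_n(3^k s)) ≤ (1-ε)^{2^k}`, `2^k ≍ log n`, `3^k = polylog(n)`, and
  `Σ_{x,y} P(x ↔ y in Λ_n) = E Σ_u N_n(u) ≤ |Λ_n| · E max_u N_n(u) ≤ |Λ_n| (3^k s + |Λ_n| n^{-7})`).
* `line_composition` (kernel-checked, no `sorry`; hypotheses = the five stub statements verbatim up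
  to the set abbreviations `quasiGiant` / `bdryQuasiGiant` / `confinedVol`, definitionally equal to the
  stub types): with `a := min a_B (a_I/4)` the split gives
  `P(QG_n(n^{3-a})) ≤ P(BQG_n(n^{3-a_B})) + 27 C_I n^{2a - a_I} ≤ 1 - ε/2` eventually, the boost gives an
  eventual power saving at `p_c`, and the landed normal form
  `FreeBoxPowerSavingNegative.of_eventually` (Theorems/FreeBoxPowerSaving/Negative/, p73056) upgrades
  it to all `n ≥ 1`; `FreeBoxPowerSaving_of` applies it to the stubs and concludes the crux BY NAME.

Disproof.lean (cdisprove v9, 2026-08-16T02:15Z, NO KILL) honoured — no `_false_without_<H>` theorem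
with a named hypothesis exists; the load-bearing analyses are answered as follows:
`not_powerSavingAt_one` / `Negative.false_at_one` (p = p_c is load-bearing): stubs 1, 4, 5 hold at
EVERY `p` and stub 2 holds at `p = 1` vacuously (`C(0) = ℤ³` is never confined), so the whole
`p`-dependence sits in `stub_boundaryQuasiGiantsNotAS`, which is FALSE at `p = 1` (the box is one
piece touching `∂ⁱⁿΛ_n`) — "the line uses H := (p = p_c) at stub 3"; `false_without_guard`: the
conclusion keeps `1 ≤ n` (crux verbatim) and stubs 2–3–5 are eventual / guarded; `exponent_le_two`
(any witness has `a ≤ 2`): the line's exponent is `≤ min(a_B, a_I/4)/2`, far below; §6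
`freeBoxPowerSaving_iff_centreRooted`: stub 2 is implied by the crux (`E[|C(0)|; C(0) ⊆ Λ_{2n}] ≤
centreVol(2n)`), so the transfer loses nothing; §9 audit: `FirstLemma2/3` "VALID reductions",
`¬FatFiniteClusterBound a` only for `a > 3` (harmless under `∃ a`).  Landed Negative lemmas imported
and checked against: `Negative/FreeBoxPowerSavingBounds.lean` (used: `of_eventually`, `fa2`);
`Negative/FreeBoxPowerSavingProfile.lean` (subcritical exponent 3: consistent — below `p_c` stub 3
holds with `ε` close to `1`).  Negatives index (8 entries): none concerns free-box connectivities;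
the `R = 0` / `p = 1` junk-parameter lesson of `PercQuarantineIslands.QuarantineInequality_refuted` was
applied to every stub (all hold at `n = 0`, `p ∈ {0,1}`, `s` non-integer).
-/

noncomputable section

open MeasureTheory Filter Topology
open scoped Classical
open Literature.Probability.Percolation Literature.Probability.LatticeModels
open Summit.CriticalPhenomena.PercolationContinuityZ3.FreeBoxPowerSavingNegative (fa2 pairSum
  of_eventually card_box_real card_box_pos)

namespace Summit.CriticalPhenomena.PercolationContinuityZ3.Cruxes.FreeBoxPowerSaving.BoundaryInteriorSplitFatFiniteClusters

/-! ## Registered stubs (statements over tree declarations only; `sorry` lives only here) -/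

/-- **stub_boundaryInteriorSplit (the boundary/interior split in one-bit form; every `p`; provable
now, size M).**  For `s > 0`:
`P_p(some in-box piece of Λ_n has ≥ s vertices)
   ≤ P_p(some piece touching ∂ⁱⁿΛ_n has ≥ s vertices) + |Λ_n| · (Σ_{y ∈ Λ_{2n}} P_p(0 ↔ y, C(0) ⊆ Λ_{2n})) / s²`.
Proof route (idea card §Lever/(I), triage-verified): an in-box piece either touches `∂ⁱⁿΛ_n` or is
interior; on the full-measure event `ω ⊆ E(ℤ³)` (`ProbabilityTheory.setBernoulli_ae_subset`) an
interior piece `P ∋ v` equals the full cluster `C(v)` (an open edge leaving `P` is a lattice edge, so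
its far endpoint is either in `Λ_n` — then in `P` — or outside — then its near endpoint is in
`∂ⁱⁿΛ_n`), and `C(v) ⊆ Λ_n ⊆ v + Λ_{2n}`; so on the interior event `Σ_{v ∈ Λ_n} 1{|C(v)| ≥ s, C(v) ⊆
v + Λ_{2n}} ≥ |P| ≥ s` (first Markov), each summand has probability `P_p(|C(0) ∩ Λ_{2n}| ≥ s, C(0) ⊆
Λ_{2n})` by translation invariance (`bondPercolation_real_preimage_shift`), which is
`≤ E_p[|C(0) ∩ Λ_{2n}| ; C(0) ⊆ Λ_{2n}] / s` (second Markov) `= (Σ_{y ∈ Λ_{2n}} P_p(0 ↔ y, C(0) ⊆ Λ_{2n}))/s`.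
Degenerate checks: `n = 0` (`∂ⁱⁿΛ_0 = Λ_0 = {0}`), `p = 1` (one piece, touching the boundary; confined
volume `0`), `p = 0`, `s > |Λ_n|` (both quasi-giant events empty) — all fine. -/
theorem stub_boundaryInteriorSplit :
    ∀ (p : unitInterval) (n : ℕ) (s : ℝ), 0 < s →
      (bondPercolation (zdGraph 3) p).real
          {ω | ∃ u ∈ box 3 n,
            s ≤ (((box 3 n).filter fun v => ω ∈ openConnIn ↑(box 3 n) u v).card : ℝ)}
        ≤ (bondPercolation (zdGraph 3) p).real
            {ω | ∃ u ∈ innerBoundary (zdGraph 3) (box 3 n),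
              s ≤ (((box 3 n).filter fun v => ω ∈ openConnIn ↑(box 3 n) u v).card : ℝ)}
          + ((box 3 n).card : ℝ) *
              (∑ y ∈ box 3 (2 * n), (bondPercolation (zdGraph 3) p).real
                (openConn 0 y ∩ {ω | openCluster ω 0 ⊆ ↑(box 3 (2 * n))})) / s ^ 2 := by
  sorry

/-- **stub_fatFiniteClusters ((I) `FatFiniteClusterBound`: confined critical clusters are not fat;
jump-free; OPEN, size L–XL — the line's distinctive target).**  For some `a > 0`:
`E_{p_c}[|C(0)| ; C(0) ⊆ Λ_{2n}] = Σ_{y ∈ Λ_{2n}} P_{p_c}(0 ↔ y, C(0) ⊆ Λ_{2n}) ≤ C n^{3-a}` (`n ≥ 1`).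
A large-deviation statement for the FINITE critical cluster ("volume `≥ n^{3-a}` at diameter
`≤ 4n`"), with no jump content (in a `θ(p_c) > 0` world it constrains only the finite clusters) and no
boundary content.  Prediction `E[|C(0)|; diam ≤ 4n] ≍ n^{2-η} = n^{2.05}`, so any `a < 0.95` should do;
mean-field calibration `≍ n²` (`d > 6`).  Implied by the bulk ball decay `Σ_{y ∈ Λ_{2n}} τ_{p_c}(0,y) ≤
C n^{3-a}` (PercTwoPointDecay) and by the crux itself (Disproof §6: `≤ centreVol(2n)`), strictly weaker
than both; known tools: animal law `P(C = A) = p^{|E(A)|}(1-p)^{|∂A|}` with AKN boundary/volume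
counting, Russo on the diameter-truncated (decreasing) part, Hutchcroft arXiv:2008.11197 Thm 2.1-type
universal volume tails.  No upper tail bound WITH A RATE for finite critical clusters is known in
`d = 3` (triage r1-2/3).  False for `a > 3` only (`y = 0` term), harmless under `∃ a`. -/
theorem stub_fatFiniteClusters :
    ∃ a C : ℝ, 0 < a ∧ ∀ n : ℕ, 1 ≤ n →
      ∑ y ∈ box 3 (2 * n), (bondPercolation (zdGraph 3) (criticalProbI 3)).real
          (openConn 0 y ∩ {ω | openCluster ω 0 ⊆ ↑(box 3 (2 * n))})
        ≤ C * (n : ℝ) ^ (3 - a) := by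
  sorry

/-- **stub_boundaryQuasiGiantsNotAS ((B) in one-bit form, `BoundaryQuasiGiantNotAS(a, ε)`; OPEN,
crux-hard — the HARDEST stub).**  For some `a, ε > 0`, eventually in `n`: with probability at least
`ε` NO in-box piece of `Λ_n` touching `∂ⁱⁿΛ_n` has `≥ n^{3-a}` vertices.  All jump-world content of the
crux is here (an in-box piece of an infinite cluster touches `∂ⁱⁿΛ_n`, since an infinite open path
leaves the box), and so is the criticality of the parameter (FALSE at `p = 1`, where the whole box is
one boundary-touching piece — matching `Negative.false_at_one`; true below `p_c`).  In the orthodox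
picture `|K_max^free| ≍ n^{d_f} = n^{2.52}` so it holds with probability `→ 1` for every `a < 0.477`; it
fails exactly in the MONOLITHIC jump branch (free-box giants), the branch route PercFiniteBoxLRO owns.
Why one-bit and not a rate (triage r1-1/2/3): by `stub_sizeSplitting` + `stub_logBoost` a probability
`≤ 1 - ε` per scale is as good as a power saving, and the card's cheap footprint/depth-profile bound
needs `Σ_{h ≤ 2n} g_h ≤ n^{1-a-ε}` with `g_h ↓ θ(p_c)`, i.e. continuity WITH a rate (summit-strength) —
deliberately NOT a stub.  Arena: boundary-touching pieces hang from a face inside that face's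
half-space (or an edge's quarter-space / a corner's orthant), where Barsky–Grimmett–Newman same-`p`
dynamic renormalisation is a theorem (`BarskyGrimmettNewman1991_Z3_holds`; Grimmett 1999 Thm 7.35, §7.5);
consumable inputs: `PercLowPointHalfSpace.QuantitativeBGN` (stmt-0913), `.TallClusterMassBound`
(stmt-0912).  Residual named by the card: fat pieces with FEW feet ("pinned"); see the line card. -/
theorem stub_boundaryQuasiGiantsNotAS :
    ∃ a ε : ℝ, 0 < a ∧ 0 < ε ∧ ∀ᶠ n : ℕ in atTop,
      (bondPercolation (zdGraph 3) (criticalProbI 3)).real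
          {ω | ∃ u ∈ innerBoundary (zdGraph 3) (box 3 n),
            (n : ℝ) ^ (3 - a) ≤
              (((box 3 n).filter fun v => ω ∈ openConnIn ↑(box 3 n) u v).card : ℝ)}
        ≤ 1 - ε := by
  sorry

/-- **stub_sizeSplitting (the square-root trick: BK size-multiplicativity of the largest free-box
piece, `k = 1`; every `p`; provable now, size M).**  For real `s ≥ 1`:
`P_p(some in-box piece has ≥ 3s vertices) ≤ P_p(some in-box piece has ≥ s vertices)²`.
Proof route (triage r1-2 App. A, re-deriving Hutchcroft arXiv:2008.11197 Thm 2.3 / Lemma 2.4 for the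
finite graph `Λ_n`): a piece with `≥ 3s` vertices has a spanning open tree `T` with `|T| ≥ ⌈3s⌉ ≥ 3m-2`,
`m := ⌈s⌉`; if `m ≥ 2`, peel at a deepest vertex whose subtree has `≥ m` vertices to get two
EDGE-disjoint open subtrees with `≥ m ≥ s` vertices each (pieces `T₁` with `m ≤ |T₁| ≤ 2m-2` and
`T ∖ (T₁ ∖ root)` with `≥ m+1`), i.e. two disjoint witnesses of the increasing finitary event
"`∃` piece `≥ s`" on the edges of `Λ_n`; conclude with `bk_finitary_list` /
`mem_disjointOccurrenceList_of_pairwise_disjoint` (in tree).  `m = 1` (i.e. `s = 1`): the right side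
is `1`.  Holds at every `p` (BK is a product-measure fact). -/
theorem stub_sizeSplitting :
    ∀ (p : unitInterval) (n : ℕ) (s : ℝ), 1 ≤ s →
      (bondPercolation (zdGraph 3) p).real
          {ω | ∃ u ∈ box 3 n,
            3 * s ≤ (((box 3 n).filter fun v => ω ∈ openConnIn ↑(box 3 n) u v).card : ℝ)}
        ≤ ((bondPercolation (zdGraph 3) p).real
            {ω | ∃ u ∈ box 3 n,
              s ≤ (((box 3 n).filter fun v => ω ∈ openConnIn ↑(box 3 n) u v).card : ℝ)}) ^ 2 := by
  sorry

/-- **stub_logBoost (tightness collapse: one bit per scale ⟹ a power saving; every `p`; real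
analysis, provable now, size M).**  If the square-root trick holds at `p` and, for some `a, ε > 0`,
eventually `P_p(some in-box piece of Λ_n has ≥ n^{3-a} vertices) ≤ 1 - ε`, then for some `a' > 0`,
eventually `FA₂(p, n) ≤ C n^{-a'}` (any `a' < a` works; e.g. `a' = a/2`).
Proof route (card 1 `FirstLemma1`, triage-verified): iterate the hypothesis along `s, 3s, 9s, …`
(`3^j s ≥ 1`) to `P(QG_n(3^k s)) ≤ (1-ε)^{2^k}`; pointwise `Σ_{u ∈ Λ_n} N_n(u) ≤ |Λ_n| · max_u N_n(u)`
and `max_u N_n(u) ≤ t + |Λ_n| · 1{QG_n(t)}`, so `Σ_{x,y} P_p(x ↔ y in Λ_n) ≤ |Λ_n| (t + |Λ_n| P(QG_n(t)))`;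
take `s = n^{3-a}`, `2^k ≈ 7 log n / log(1/(1-ε))` (so `(1-ε)^{2^k} ≤ n^{-7}`, `3^k ≤ 3 (2^k)^{1.59} =
O_ε((log n)^{1.59})`), `t = 3^k s`: `FA₂ ≤ 3^k n^{3-a}/n³ + 216 n^{-4} ≤ C n^{-a/2}` eventually.
At `p = 1` the second hypothesis fails for every `a` (the box is one piece), so no conflict with
`Negative.false_at_one`. -/
theorem stub_logBoost :
    ∀ (p : unitInterval),
      (∀ (n : ℕ) (s : ℝ), 1 ≤ s →
        (bondPercolation (zdGraph 3) p).real
            {ω | ∃ u ∈ box 3 n,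
              3 * s ≤ (((box 3 n).filter fun v => ω ∈ openConnIn ↑(box 3 n) u v).card : ℝ)}
          ≤ ((bondPercolation (zdGraph 3) p).real
              {ω | ∃ u ∈ box 3 n,
                s ≤ (((box 3 n).filter fun v => ω ∈ openConnIn ↑(box 3 n) u v).card : ℝ)}) ^ 2) →
      ∀ (a ε : ℝ), 0 < a → 0 < ε →
        (∀ᶠ n : ℕ in atTop,
          (bondPercolation (zdGraph 3) p).real
              {ω | ∃ u ∈ box 3 n,
                (n : ℝ) ^ (3 - a) ≤
                  (((box 3 n).filter fun v => ω ∈ openConnIn ↑(box 3 n) u v).card : ℝ)}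
            ≤ 1 - ε) →
        ∃ a' C : ℝ, 0 < a' ∧ ∀ᶠ n : ℕ in atTop,
          (∑ x ∈ box 3 n, ∑ y ∈ box 3 n,
              (bondPercolation (zdGraph 3) p).real (openConnIn ↑(box 3 n) x y))
            / ((box 3 n).card : ℝ) ^ 2 ≤ C * (n : ℝ) ^ (-a') := by
  sorry

/-! ## Notation for the glue (sets and numbers only — no statement is hidden behind a name) -/

/-- `N_n(u, ω)`: number of vertices of `Λ_n` joined to `u` by an open path inside `Λ_n`
(`0` if `u ∉ Λ_n`).  The stubs spell this term out; the glue below abbreviates it. -/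
def pieceSize (n : ℕ) (u : Site 3) (ω : BondConfig (Site 3)) : ℕ :=
  ((box 3 n).filter fun v => ω ∈ openConnIn ↑(box 3 n) u v).card

/-- `QG_n(s)`: some in-box piece of `Λ_n` has at least `s` vertices. -/
def quasiGiant (n : ℕ) (s : ℝ) : Set (BondConfig (Site 3)) :=
  {ω | ∃ u ∈ box 3 n, s ≤ (pieceSize n u ω : ℝ)}

/-- `BQG_n(s)`: some in-box piece of `Λ_n` touching `∂ⁱⁿΛ_n` has at least `s` vertices. -/
def bdryQuasiGiant (n : ℕ) (s : ℝ) : Set (BondConfig (Site 3)) :=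
  {ω | ∃ u ∈ innerBoundary (zdGraph 3) (box 3 n), s ≤ (pieceSize n u ω : ℝ)}

/-- `E_p[|C(0)| ; C(0) ⊆ Λ_m] = Σ_{y ∈ Λ_m} P_p(0 ↔ y, C(0) ⊆ Λ_m)` (confined volume). -/
def confinedVol (p : unitInterval) (m : ℕ) : ℝ :=
  ∑ y ∈ box 3 m, (bondPercolation (zdGraph 3) p).real
    (openConn 0 y ∩ {ω | openCluster ω 0 ⊆ ↑(box 3 m)})

/-! ## Composition (kernel-checked, no `sorry`) -/

theorem confinedVol_nonneg (p : unitInterval) (m : ℕ) : 0 ≤ confinedVol p m :=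
  Finset.sum_nonneg fun _ _ => measureReal_nonneg

/-- Quasi-giant events are antitone in the threshold. -/
theorem bdryQuasiGiant_anti (n : ℕ) {s t : ℝ} (hst : s ≤ t) : bdryQuasiGiant n t ⊆ bdryQuasiGiant n s := by
  rintro ω ⟨u, hu, h⟩
  exact ⟨u, hu, hst.trans h⟩

/-- `|Λ_n| ≤ 27 n³` for `n ≥ 1`. -/
theorem card_box_le {n : ℕ} (hn : 1 ≤ n) : ((box 3 n).card : ℝ) ≤ 27 * (n : ℝ) ^ 3 := by
  have hn' : (1 : ℝ) ≤ n := by exact_mod_cast hn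
  rw [card_box_real]
  have h3 : 2 * (n : ℝ) + 1 ≤ 3 * n := by linarith
  calc (2 * (n : ℝ) + 1) ^ 3 ≤ (3 * n) ^ 3 := by gcongr
    _ = 27 * (n : ℝ) ^ 3 := by ring

/-- The interior error term: `|Λ_n| · CV(2n) / (n^{3-a})² ≤ 27 C⁺ n^{-a_I/2}` when
`CV(2n) ≤ C_I n^{3-a_I}` and `a ≤ a_I / 4`. -/
theorem interior_term_le {n : ℕ} (hn : 1 ≤ n) {a aI CI V : ℝ} (hV0 : 0 ≤ V)
    (hV : V ≤ CI * (n : ℝ) ^ (3 - aI)) (ha : a ≤ aI / 4) :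
    ((box 3 n).card : ℝ) * V / ((n : ℝ) ^ (3 - a)) ^ 2 ≤ 27 * max CI 0 * (n : ℝ) ^ (-(aI / 2)) := by
  have hN1 : (1 : ℝ) ≤ n := by exact_mod_cast hn
  have hN0 : (0 : ℝ) < n := by linarith
  have hM : 0 ≤ max CI 0 := le_max_right _ _
  have hV' : V ≤ max CI 0 * (n : ℝ) ^ (3 - aI) :=
    hV.trans (mul_le_mul_of_nonneg_right (le_max_left _ _) (Real.rpow_nonneg hN0.le _))
  have hpow3 : (n : ℝ) ^ (3 : ℕ) = (n : ℝ) ^ (3 : ℝ) := by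
    rw [show (3 : ℝ) = ((3 : ℕ) : ℝ) by norm_num, Real.rpow_natCast]
  have hsq : ((n : ℝ) ^ (3 - a)) ^ 2 = (n : ℝ) ^ ((3 - a) + (3 - a)) := by
    rw [sq, ← Real.rpow_add hN0]
  have hden : 0 < (n : ℝ) ^ ((3 - a) + (3 - a)) := Real.rpow_pos_of_pos hN0 _
  rw [hsq, div_le_iff₀ hden]
  calc ((box 3 n).card : ℝ) * V ≤ (27 * (n : ℝ) ^ 3) * (max CI 0 * (n : ℝ) ^ (3 - aI)) :=
        mul_le_mul (card_box_le hn) hV' hV0 (by positivity)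
    _ = 27 * max CI 0 * ((n : ℝ) ^ (3 : ℝ) * (n : ℝ) ^ (3 - aI)) := by rw [← hpow3]; ring
    _ = 27 * max CI 0 * (n : ℝ) ^ (3 + (3 - aI)) := by rw [← Real.rpow_add hN0]
    _ ≤ 27 * max CI 0 * (n : ℝ) ^ (-(aI / 2) + ((3 - a) + (3 - a))) := by
        apply mul_le_mul_of_nonneg_left _ (by positivity)
        exact Real.rpow_le_rpow_of_exponent_le hN1 (by linarith)
    _ = 27 * max CI 0 * (n : ℝ) ^ (-(aI / 2)) * (n : ℝ) ^ ((3 - a) + (3 - a)) := by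
        rw [Real.rpow_add hN0]; ring

/-- **Interior + boundary ⟹ all quasi-giants not a.s.** (sorry-free; hypotheses = the statements
of stubs 1–3, definitionally): with `a := min a_B (a_I/4)`,
`P_{p_c}(QG_n(n^{3-a})) ≤ P_{p_c}(BQG_n(n^{3-a_B})) + 27 C_I⁺ n^{-a_I/2} ≤ 1 - ε/2` eventually. -/
theorem quasiGiantsNotAS_of_parts
    (hSplit : ∀ (p : unitInterval) (n : ℕ) (s : ℝ), 0 < s →
      (bondPercolation (zdGraph 3) p).real (quasiGiant n s)
        ≤ (bondPercolation (zdGraph 3) p).real (bdryQuasiGiant n s)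
          + ((box 3 n).card : ℝ) * confinedVol p (2 * n) / s ^ 2)
    (hFat : ∃ a C : ℝ, 0 < a ∧ ∀ n : ℕ, 1 ≤ n →
      confinedVol (criticalProbI 3) (2 * n) ≤ C * (n : ℝ) ^ (3 - a))
    (hBdry : ∃ a ε : ℝ, 0 < a ∧ 0 < ε ∧ ∀ᶠ n : ℕ in atTop,
      (bondPercolation (zdGraph 3) (criticalProbI 3)).real (bdryQuasiGiant n ((n : ℝ) ^ (3 - a)))
        ≤ 1 - ε) :
    ∃ a ε : ℝ, 0 < a ∧ 0 < ε ∧ ∀ᶠ n : ℕ in atTop,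
      (bondPercolation (zdGraph 3) (criticalProbI 3)).real (quasiGiant n ((n : ℝ) ^ (3 - a)))
        ≤ 1 - ε := by
  obtain ⟨aI, CI, haI, hCV⟩ := hFat
  obtain ⟨aB, ε, haB, hε, hevB⟩ := hBdry
  set a : ℝ := min aB (aI / 4) with ha_def
  have ha : 0 < a := lt_min haB (by linarith)
  have haB' : a ≤ aB := min_le_left _ _
  have haI' : a ≤ aI / 4 := min_le_right _ _
  refine ⟨a, ε / 2, ha, by linarith, ?_⟩
  -- the interior error term tends to zero
  have hlim : Tendsto (fun n : ℕ => 27 * max CI 0 * (n : ℝ) ^ (-(aI / 2))) atTop (𝓝 0) := by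
    have h := ((tendsto_rpow_neg_atTop (by linarith : 0 < aI / 2)).comp
      tendsto_natCast_atTop_atTop).const_mul (27 * max CI 0)
    simpa using h
  have hsmall : ∀ᶠ n : ℕ in atTop, 27 * max CI 0 * (n : ℝ) ^ (-(aI / 2)) ≤ ε / 2 :=
    hlim.eventually (ge_mem_nhds (by linarith))
  filter_upwards [hevB, hsmall, eventually_ge_atTop 1] with n hB hsm hn1
  have hN1 : (1 : ℝ) ≤ n := by exact_mod_cast hn1
  have hN0 : (0 : ℝ) < n := by linarith
  have hs : 0 < (n : ℝ) ^ (3 - a) := Real.rpow_pos_of_pos hN0 _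
  -- thresholds: `n^{3-a_B} ≤ n^{3-a}`
  have hthr : (n : ℝ) ^ (3 - aB) ≤ (n : ℝ) ^ (3 - a) :=
    Real.rpow_le_rpow_of_exponent_le hN1 (by linarith)
  calc (bondPercolation (zdGraph 3) (criticalProbI 3)).real (quasiGiant n ((n : ℝ) ^ (3 - a)))
      ≤ (bondPercolation (zdGraph 3) (criticalProbI 3)).real (bdryQuasiGiant n ((n : ℝ) ^ (3 - a)))
          + ((box 3 n).card : ℝ) * confinedVol (criticalProbI 3) (2 * n) / ((n : ℝ) ^ (3 - a)) ^ 2 :=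
        hSplit _ n _ hs
    _ ≤ (bondPercolation (zdGraph 3) (criticalProbI 3)).real (bdryQuasiGiant n ((n : ℝ) ^ (3 - aB)))
          + 27 * max CI 0 * (n : ℝ) ^ (-(aI / 2)) := by
        gcongr ?_ + ?_
        · exact measureReal_mono (bdryQuasiGiant_anti n hthr) (measure_ne_top _ _)
        · exact interior_term_le hn1 (confinedVol_nonneg _ _) (hCV n hn1) haI'
    _ ≤ (1 - ε) + ε / 2 := add_le_add hB hsm
    _ = 1 - ε / 2 := by ring

/-- **Composition lemma (sorry-free; hypotheses = the five stub statements, definitionally — the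
stubs spell out `quasiGiant` / `bdryQuasiGiant` / `confinedVol` / `fa2`).**  The conclusion is the
crux UNFOLDED (`FreeBoxPowerSaving_of` restates it by name): stubs 1–3 give "quasi-giants at
threshold `n^{3-a}` are not asymptotically almost sure" at `p_c`, stubs 4–5 boost that one bit per
scale to an eventual power saving, and the landed normal form `FreeBoxPowerSavingNegative.of_eventually`
upgrades it to all `n ≥ 1`. -/
theorem line_composition
    (hSplit : ∀ (p : unitInterval) (n : ℕ) (s : ℝ), 0 < s →
      (bondPercolation (zdGraph 3) p).real (quasiGiant n s)
        ≤ (bondPercolation (zdGraph 3) p).real (bdryQuasiGiant n s)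
          + ((box 3 n).card : ℝ) * confinedVol p (2 * n) / s ^ 2)
    (hFat : ∃ a C : ℝ, 0 < a ∧ ∀ n : ℕ, 1 ≤ n →
      confinedVol (criticalProbI 3) (2 * n) ≤ C * (n : ℝ) ^ (3 - a))
    (hBdry : ∃ a ε : ℝ, 0 < a ∧ 0 < ε ∧ ∀ᶠ n : ℕ in atTop,
      (bondPercolation (zdGraph 3) (criticalProbI 3)).real (bdryQuasiGiant n ((n : ℝ) ^ (3 - a)))
        ≤ 1 - ε)
    (hSqrt : ∀ (p : unitInterval) (n : ℕ) (s : ℝ), 1 ≤ s →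
      (bondPercolation (zdGraph 3) p).real (quasiGiant n (3 * s))
        ≤ ((bondPercolation (zdGraph 3) p).real (quasiGiant n s)) ^ 2)
    (hBoost : ∀ p : unitInterval,
      (∀ (n : ℕ) (s : ℝ), 1 ≤ s →
        (bondPercolation (zdGraph 3) p).real (quasiGiant n (3 * s))
          ≤ ((bondPercolation (zdGraph 3) p).real (quasiGiant n s)) ^ 2) →
      ∀ (a ε : ℝ), 0 < a → 0 < ε →
        (∀ᶠ n : ℕ in atTop,
          (bondPercolation (zdGraph 3) p).real (quasiGiant n ((n : ℝ) ^ (3 - a))) ≤ 1 - ε) →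
        ∃ a' C : ℝ, 0 < a' ∧ ∀ᶠ n : ℕ in atTop, fa2 p n ≤ C * (n : ℝ) ^ (-a')) :
    ∃ a C : ℝ, 0 < a ∧ ∀ n : ℕ, 1 ≤ n →
      (∑ x ∈ box 3 n, ∑ y ∈ box 3 n,
          (bondPercolation (zdGraph 3) (criticalProbI 3)).real (openConnIn ↑(box 3 n) x y))
        / ((box 3 n).card : ℝ) ^ 2 ≤ C * (n : ℝ) ^ (-a) := by
  obtain ⟨a, ε, ha, hε, hQG⟩ := quasiGiantsNotAS_of_parts hSplit hFat hBdry
  obtain ⟨a', C, ha', hev⟩ := hBoost (criticalProbI 3) (hSqrt (criticalProbI 3)) a ε ha hε hQG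
  obtain ⟨C', hC'⟩ := of_eventually ha' hev
  exact ⟨a', C', ha', fun n hn => hC' n hn⟩

/-- **The line concludes the crux BY NAME** from the five registered stubs; no `sorry` of its own
(its only non-standard axiom is the `sorryAx` of the stubs, which disappears as they land). -/
theorem FreeBoxPowerSaving_of :
    Summit.CriticalPhenomena.PercolationContinuityZ3.Theses.PercNonProliferation.FreeBoxPowerSaving :=
  line_composition stub_boundaryInteriorSplit stub_fatFiniteClusters stub_boundaryQuasiGiantsNotAS
    stub_sizeSplitting stub_logBoost

end Summit.CriticalPhenomena.PercolationContinuityZ3.Cruxes.FreeBoxPowerSaving.BoundaryInteriorSplitFatFiniteClusters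

end
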